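import Mathlib
import HarnessLib

/-!
# Crux `NoZenoR` / `NoZeno` (stmt-ResolutionOfSingularities-19943 / -16483), β2 descent, `stub_L1wCore` (F1) route,
# brick G-comb: in an acyclic incidence graph a node curve separates its two old neighbours, so a Z-trivial
# connected configuration avoiding it misses an old curve

OURS (cell res-hironaka, chain W4.4; stub worker res-L0-w44-stub-2 g11; plan `L1W-PREP.md` 4a61d05beab993ff §3.3
«G-comb (pure combinatorics)», STEP 3 (3) of the (x1) six lines over the splitting base (tri-1 TRIAGE v6.6 §28.2):
«`P ≠ ∅` ⇒ the connected component `C` of the Z-trivial curves misses an OLD vertex — a removed node curve `n_x`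
separates its two old neighbours; a removed old vertex is missed by all»).  Pure graph theory over Mathlib's
`SimpleGraph`; nothing here is a statement of the manuscript under review; AI-written, weaker than expert review.

The geometric inputs (the incidence graph of the exceptional configuration of `X¹_B` is acyclic — indeed the edge
subdivision of the TREE of `X_B`, (F-b) over the rational splitting base — and each node curve `n_x` has exactly the
two old neighbours it subdivides) are NOT here; this file is the combinatorial step only, stated for an arbitrary
acyclic simple graph:

* `IsAcyclic.mem_support_of_adj_of_adj` — if `n` is adjacent to `a ≠ b` in an ACYCLIC graph, every walk from `a`
  to `b` passes through `n` (the path `a – n – b` is the unique path);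
* `IsAcyclic.not_mem_or_not_mem_of_walkConnected` — hence a vertex set `C ∌ n` inside which any two vertices are
  joined by a walk staying in `C` cannot contain both `a` and `b`;
* `IsAcyclic.exists_not_mem_of_walkConnected` — **G-comb**: if `P` is a set of vertices disjoint from such a `C`
  containing either a vertex of `O` («old curves») or a vertex `n` with two distinct neighbours in `O` («node
  curve»), then some vertex of `O` is not in `C`.
-/

-- single-problem summit: the doubled namespace component `ResolutionOfSingularities` is forced
set_option linter.dupNamespace false

namespace Summit.ResolutionOfSingularities.ResolutionOfSingularities.Theorems.NoZeno.ExcCount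

open SimpleGraph

variable {V : Type*} {G : SimpleGraph V}

/-- **In an acyclic graph a common neighbour separates**: if `n` is adjacent to `a` and to `b`, `a ≠ b`, then every
walk from `a` to `b` passes through `n` (its bypass is a path, and `a – n – b` is the unique path). [this work] -/
theorem IsAcyclic.mem_support_of_adj_of_adj (hG : G.IsAcyclic) {a b n : V} (hab : a ≠ b) (ha : G.Adj n a)
    (hb : G.Adj n b) (p : G.Walk a b) : n ∈ p.support := by
  classical
  -- the path `a – n – b`
  let q : G.Walk a b := Walk.cons ha.symm (Walk.cons hb Walk.nil)
  have hq : q.IsPath := by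
    rw [Walk.isPath_def]
    have h1 : a ≠ n := ha.symm.ne
    have h2 : n ≠ b := hb.ne
    simp [q, h1, h2, hab]
  -- the bypass of `p` is a path from `a` to `b`, hence equal to `q`
  have huniq := hG.path_unique ⟨p.bypass, p.bypass_isPath⟩ ⟨q, hq⟩
  have hmem : n ∈ p.bypass.support := by
    have : p.bypass = q := congrArg Subtype.val huniq
    rw [this]
    simp [q]
  exact p.support_bypass_subset_support hmem

/-- If `C ∌ n` is «walk-connected» (any two of its vertices are joined by a walk with support in `C`) and `n` is a
common neighbour of `a ≠ b` in an acyclic graph, then `a` and `b` are not both in `C`. [this work] -/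
theorem IsAcyclic.not_mem_or_not_mem_of_walkConnected (hG : G.IsAcyclic) {a b n : V} (hab : a ≠ b)
    (ha : G.Adj n a) (hb : G.Adj n b) {C : Set V} (hn : n ∉ C)
    (hC : ∀ x ∈ C, ∀ y ∈ C, ∃ p : G.Walk x y, ∀ v ∈ p.support, v ∈ C) : a ∉ C ∨ b ∉ C := by
  by_contra h
  simp only [not_or, not_not] at h
  obtain ⟨p, hp⟩ := hC a h.1 b h.2
  exact hn (hp n (IsAcyclic.mem_support_of_adj_of_adj hG hab ha hb p))

/-- **G-comb.**  `G` acyclic; `O` a set of («old») vertices; `C` a walk-connected vertex set; `P` a set of vertices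
disjoint from `C` which contains either an old vertex or a vertex `n` adjacent to two distinct old vertices.  Then
some old vertex is not in `C`. [this work] -/
theorem IsAcyclic.exists_not_mem_of_walkConnected (hG : G.IsAcyclic) {O C P : Set V}
    (hC : ∀ x ∈ C, ∀ y ∈ C, ∃ p : G.Walk x y, ∀ v ∈ p.support, v ∈ C) (hPC : Disjoint P C)
    (hP : (∃ o ∈ P, o ∈ O) ∨ ∃ n ∈ P, ∃ a ∈ O, ∃ b ∈ O, a ≠ b ∧ G.Adj n a ∧ G.Adj n b) :
    ∃ o ∈ O, o ∉ C := by
  rcases hP with ⟨o, hoP, hoO⟩ | ⟨n, hnP, a, haO, b, hbO, hab, hna, hnb⟩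
  · exact ⟨o, hoO, fun hoC => hPC.le_bot ⟨hoP, hoC⟩⟩
  · have hnC : n ∉ C := fun hnC => hPC.le_bot ⟨hnP, hnC⟩
    rcases IsAcyclic.not_mem_or_not_mem_of_walkConnected hG hab hna hnb hnC hC with h | h
    · exact ⟨a, haO, h⟩
    · exact ⟨b, hbO, h⟩

/-- **Counting form of G-comb**: with `O` finite, the old vertices inside `C` are at most `|O| − 1`. [this work] -/
theorem IsAcyclic.ncard_inter_le_of_walkConnected (hG : G.IsAcyclic) {O C P : Set V} (hO : O.Finite)
    (hC : ∀ x ∈ C, ∀ y ∈ C, ∃ p : G.Walk x y, ∀ v ∈ p.support, v ∈ C) (hPC : Disjoint P C)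
    (hP : (∃ o ∈ P, o ∈ O) ∨ ∃ n ∈ P, ∃ a ∈ O, ∃ b ∈ O, a ≠ b ∧ G.Adj n a ∧ G.Adj n b) :
    (O ∩ C).ncard + 1 ≤ O.ncard := by
  obtain ⟨o, hoO, hoC⟩ := IsAcyclic.exists_not_mem_of_walkConnected hG hC hPC hP
  have hsub : O ∩ C ⊆ O \ {o} := by
    rintro x ⟨hxO, hxC⟩
    exact ⟨hxO, fun hx => hoC (by rw [Set.mem_singleton_iff.mp hx] at hxC; exact hxC)⟩
  have h1 : (O ∩ C).ncard ≤ (O \ {o}).ncard := Set.ncard_le_ncard hsub hO.sdiff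
  have h2 : (O \ {o}).ncard + 1 = O.ncard := by
    rw [Set.ncard_sdiff_singleton_add_one hoO hO]
  omega

end Summit.ResolutionOfSingularities.ResolutionOfSingularities.Theorems.NoZeno.ExcCount
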